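import Literature.AlgebraicGeometry.Resolution.LogBlowupOrthant
import Literature.AlgebraicGeometry.Resolution.LogRegularFreeStalk
import Literature.Geometry.PolyhedralFans.RegularBasis
import HarnessLib

/-!
# Crux `FrobeniusLadder.FRationalResolution` (stmt-ResolutionOfSingularities-15317), line `redirect`,
# stub `stub_diagonalizableQuotientResolution` — at a «fixed» point of a log regular chart, a REGULAR cone means a REGULAR
# point (the converse input of assembly (ε₁′): a singular point has a non-regular face fan)

Kato 1994 (10.4), last step («`M̄ ≅ ℕ^r` ⇒ regular», tree: `LogRegularFreeStalk`), in the fan currency of the assembly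
`…PrimaryCentreAtIsolatedPointFan.exists_primary_monomialCentre_of_isolated'`, whose hypothesis `hnreg` («the face fan
of `P^∨` is not regular») has to be discharged from «`A_𝔮` is not regular»: **if the face fan of `P^∨` is regular and
`φ(P ∖ 0) ⊆ 𝔮` (unit face `0`), then `A_𝔮` is a regular local ring.** Proof: `P^∨ = hull S` with `S` regular; by the dual
basis (`IsRegularGens.exists_dual_basis`) and saturation (`mem_of_forall_dualCone`) `P = {u : e^*_i(u) ≥ 0, i ∈ I}`; the
units `±e_j`, `j ∉ I`, are excluded by `φ(P ∖ 0) ⊆ 𝔮` (`φ(e_j) φ(−e_j) = 1`), so `P` is generated by the `n` basis vectors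
`e_i`, Kato's ideal `I(𝔮) A_𝔮` by the `n` monomials `φ(e_i)`, and `LogChart.isRegularLocalRing_of_isLogRegularAt_of_span_eq`
concludes.

* **`LogChart.isRegularLocalRing_of_isRegular_ofCone`** — the statement.

Honest label: dictionary (no stub closed). No definitions, no named facts, no sorry. [cite: Kato1994, Def. (2.1), (10.4)]
[cite: Fulton1993Toric, §1.3, §2.1]
-/

noncomputable section

namespace Literature.AlgebraicGeometry.Resolution.LogChart

open Literature.Geometry.PolyhedralFans Literature.AlgebraicGeometry.Resolution.LogBlowup PointedCone IsLocalRing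
open Literature.Combinatorics.Optimization.HilbertBasis (toRat toRat_add toRat_zero toRat_nsmul toRat_sum)

universe v

variable {A : Type v} [CommRing A] [IsNoetherianRing A] {n : ℕ} {P : AddSubmonoid (Fin n → ℤ)}
  {φ : Multiplicative P →* A} {𝔮 : Ideal A} [𝔮.IsPrime]

/-- **Regular face fan at a «fixed» point ⇒ regular local ring.** Let `φ : P → A` (`P ⊆ ℤⁿ` finitely generated, saturated,
spanning; `A` Noetherian) be log regular at the prime `𝔮` with `φ(P ∖ 0) ⊆ 𝔮`. If the face fan of `P^∨` is regular then
`A_𝔮` is a regular local ring. [cite: Kato1994, (10.4) with Def. (2.1)] [cite: Fulton1993Toric, §1.3] -/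
theorem isRegularLocalRing_of_isRegular_ofCone (hP : P.FG)
    (hsat : ∀ (v : Fin n → ℤ) (k : ℕ), 0 < k → k • v ∈ P → v ∈ P)
    (hspan : Submodule.span ℤ (P : Set (Fin n → ℤ)) = ⊤) (hreg : IsLogRegularAt P φ 𝔮)
    (hfix : ∀ p : P, (p : Fin n → ℤ) ≠ 0 → φ (Multiplicative.ofAdd p) ∈ 𝔮)
    (hΔ : (Fan.ofCone (dualCone P) (dualCone_fg P hP) (isSalient_dualCone P hspan)).IsRegular) :
    IsRegularLocalRing (Localization.AtPrime 𝔮) := by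
  classical
  -- `σ = hull S`, `S` regular; the dual basis
  obtain ⟨S, hSreg, hσS⟩ := hΔ (Fan.self_mem_ofCone (dualCone_fg P hP) (isSalient_dualCone P hspan))
  obtain ⟨e, I, -, hiff⟩ := hSreg.exists_dual_basis
  -- `P = {u : e^*_i(u) ≥ 0 ∀ i ∈ I}`
  have hmemP : ∀ u : Fin n → ℤ, u ∈ P ↔ ∀ i ∈ I, 0 ≤ e.repr u i := by
    intro u
    rw [← hiff u]
    constructor
    · intro hu s hs
      have hsσ : s ∈ dualCone P := by rw [hσS]; exact PointedCone.subset_hull hs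
      exact (mem_dualCone_iff P).1 hsσ u hu
    · intro hu
      refine mem_of_forall_dualCone P hP hsat fun v hv => ?_
      rw [hσS] at hv
      exact (forall_mem_hull_dotProduct_nonneg_iff S _).2 hu v hv
  -- `φ(0) = 1 ∉ 𝔮`; units of `P` are trivial, so `I = univ`
  have h1 : φ (Multiplicative.ofAdd (0 : P)) ∉ 𝔮 := by
    rw [ofAdd_zero, map_one]
    exact fun h => ‹𝔮.IsPrime›.ne_top (Ideal.eq_top_of_isUnit_mem _ h isUnit_one)
  have heP : ∀ j, e j ∈ P := fun j => by
    rw [hmemP]; intro i _; rw [Module.Basis.repr_self_apply]; split_ifs <;> simp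
  have hI : ∀ j, j ∈ I := by
    intro j
    by_contra hj
    have hneg : -e j ∈ P := by
      rw [hmemP]; intro i hi
      rw [map_neg, Finsupp.neg_apply, Module.Basis.repr_self_apply]
      split_ifs with h
      · subst h; exact absurd hi hj
      · simp
    have hunit : φ (Multiplicative.ofAdd (⟨e j, heP j⟩ : P)) * φ (Multiplicative.ofAdd (⟨-e j, hneg⟩ : P)) = 1 := by
      rw [← map_mul, ← ofAdd_add]
      have : (⟨e j, heP j⟩ : P) + ⟨-e j, hneg⟩ = 0 := Subtype.ext (by simp)
      rw [this, ofAdd_zero, map_one]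
    have hmem : φ (Multiplicative.ofAdd (⟨e j, heP j⟩ : P)) ∈ 𝔮 := hfix _ (e.ne_zero j)
    exact ‹𝔮.IsPrime›.ne_top (Ideal.eq_top_of_isUnit_mem _ hmem (isUnit_iff_exists_inv.2 ⟨_, hunit⟩))
  -- every `u ∈ P` is an `ℕ`-combination of the `e i`
  have hdecomp : ∀ u ∈ P, ∃ c : Fin n → ℕ, u = ∑ i, c i • e i := by
    intro u hu
    have hnn : ∀ i, 0 ≤ e.repr u i := fun i => (hmemP u).1 hu i (hI i)
    refine ⟨fun i => (e.repr u i).toNat, ?_⟩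
    conv_lhs => rw [← e.sum_repr u]
    refine Finset.sum_congr rfl fun i _ => ?_
    rw [← natCast_zsmul, Int.toNat_of_nonneg (hnn i)]
  -- Kato's ideal is generated by the `n` monomials `φ(e i)`
  set R := Localization.AtPrime 𝔮 with hR
  let gmon : Fin n → R := fun i => algebraMap A R (φ (Multiplicative.ofAdd (⟨e i, heP i⟩ : P)))
  have hideal : Ideal.span ((Finset.univ.image gmon : Finset R) : Set R) = (ideal P φ 𝔮).map (algebraMap A R) := by
    apply le_antisymm
    · rw [Ideal.span_le]
      intro x hx
      obtain ⟨i, -, rfl⟩ := Finset.mem_image.1 (Finset.mem_coe.1 hx)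
      exact Ideal.mem_map_of_mem _ (Ideal.subset_span ⟨⟨e i, heP i⟩, hfix _ (e.ne_zero i), rfl⟩)
    · rw [ideal, Ideal.map_span, Ideal.span_le]
      rintro _ ⟨_, ⟨p, hp, rfl⟩, rfl⟩
      -- `p ≠ 0`, `p = Σ c i • e i` with some `c i > 0`
      have hp0 : (p : Fin n → ℤ) ≠ 0 := by
        intro h0
        have : p = 0 := Subtype.ext h0
        rw [this] at hp
        exact h1 hp
      obtain ⟨c, hc⟩ := hdecomp p p.2
      obtain ⟨i, hci⟩ : ∃ i, c i ≠ 0 := by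
        by_contra hnone
        push Not at hnone
        apply hp0
        rw [hc]
        exact Finset.sum_eq_zero fun i _ => by rw [hnone i, zero_smul]
      -- `p = e i + rest` in `P`
      have hrest : ∑ j, (if j = i then c j - 1 else c j) • e j ∈ P :=
        AddSubmonoid.sum_mem _ fun j _ => AddSubmonoid.nsmul_mem _ (heP j) _
      have hpeq : p = ⟨e i, heP i⟩ + ⟨_, hrest⟩ := by
        apply Subtype.ext
        simp only [AddSubmonoid.coe_add]
        rw [hc, ← Finset.add_sum_erase Finset.univ _ (Finset.mem_univ i),
          ← Finset.add_sum_erase Finset.univ (fun j => (if j = i then c j - 1 else c j) • e j) (Finset.mem_univ i)]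
        have hsum : ∑ x ∈ Finset.univ.erase i, (if x = i then c x - 1 else c x) • e x =
            ∑ x ∈ Finset.univ.erase i, c x • e x :=
          Finset.sum_congr rfl fun j hj => by rw [if_neg (Finset.ne_of_mem_erase hj)]
        rw [hsum, ← add_assoc]
        congr 1
        obtain ⟨k, hk⟩ := Nat.exists_eq_succ_of_ne_zero hci
        rw [hk, if_pos rfl, Nat.succ_sub_one, succ_nsmul']
      rw [SetLike.mem_coe, hpeq]
      beta_reduce
      rw [ofAdd_add, map_mul, map_mul]
      exact Ideal.mul_mem_right _ _ (Ideal.subset_span (Finset.mem_coe.2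
        (Finset.mem_image.2 ⟨i, Finset.mem_univ _, rfl⟩)))
  -- the unit face is `{0}`, of rank `0`
  have hface : ((fun p : P => (p : Fin n → ℤ)) '' face P φ 𝔮) = {0} := by
    ext v
    simp only [Set.mem_image, mem_face_iff, Set.mem_singleton_iff]
    constructor
    · rintro ⟨p, hp, rfl⟩
      by_contra h0
      exact hp (hfix p h0)
    · rintro rfl
      exact ⟨0, h1, rfl⟩
  refine isRegularLocalRing_of_isLogRegularAt_of_span_eq P φ 𝔮 hreg (Finset.univ.image gmon) hideal ?_
  rw [hface, Submodule.span_singleton_eq_bot.2 rfl, finrank_bot, Nat.sub_zero]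
  exact (Finset.card_image_le).trans (by rw [Finset.card_univ, Fintype.card_fin])

end Literature.AlgebraicGeometry.Resolution.LogChart

end
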